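import Summits.ResolutionOfSingularities.ResolutionOfSingularities.Theorems.EquisingularLiftEquisingularLiftNatClusterLiftCharts
import Mathlib
import HarnessLib

/-!
# [OURS · L1 W4.5(b)] T-CLUSTER-LIFT part 6 — the INDEPENDENCE clause as a SURJECTIVITY onto the product of the local jet rings
# `k[T_σ]_d → Π_t k[U_{≠ i_t}] ⧸ 𝔪_{a_t}^{m_t}` («`H⁰(𝒪_e(d)) → ⊕_t 𝒪_{e,q_t}/𝔪_{q_t}^{m_t}` onto»), equivalent to part 1's jet clause `hind`,
# and the cluster lift stated with it (crux `EquisingularLiftNat` = stmt-ResolutionOfSingularities-20038, line `sections`; v7′/v7″)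

NOT a statement of any manuscript. Helper file of the chain res-L1-w45b (cell `res-hironaka`, LADDER-RESOLUTION rung L, slot
W4.5(b)); OURS; AI-written, weaker than expert review; `--supports stmt-ResolutionOfSingularities-20038 --as helper` by
res-L1-w45b-stub-3 (object T-CLUSTER-LIFT, part 6 = offer (B) of HOME STATUS 11:3xZ). No `sorry`; standard axioms.

WHAT. res-L1-w45b-lead-2 (LEAD-MEMO-6 §3) lists two candidate coordinate-free spellings of the v7′/v7″ downstairs clause: Čech `H¹`
of the twisted cluster ideal, or SURJECTIVITY of `H⁰(e, 𝒪_e(d)) → ⊕_j 𝒪/𝔪^{m_j}`. The second is, chart by chart, the surjectivity of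
the `k`-linear map «degree-`d` forms `→ Π_t k[U_{≠ i_t}] ⧸ 𝔪_{a_t}^{m_t}`, `g ↦ (g(T_{i_t} := 1) mod 𝔪_{a_t}^{m_t})_t`» — the local
rings `𝒪_{e,q_t}/𝔪_{q_t}^{m_t}` ARE the quotients `k[U]/𝔪_{a_t}^{m_t}` on any chart containing `q_t`. This file proves that this
surjectivity is EQUIVALENT to part 1's jet clause `hind` and restates the cluster lift with it:

* `forall_coeff_eq_of_forall_mk_eq` / `forall_mk_eq_of_forall_coeff_eq` — passing between «all classes mod `𝔪_{a_t}^{m_t}` prescribed»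
  and «all jets of order `< m_t` prescribed» (parts 1/3 dictionaries);
* **`hind_iff_quotient_surjective`** — `(∀ v, ∃ g ∈ k[T]_d, jets = v) ↔ (∀ c, ∃ g ∈ k[T]_d, ∀ t, mk (g(T_{i_t} := 1)) = c t)`;
* **`exists_isHomogeneous_lift_forall_dehomogenize_mem_pow_of_quotient_surjective`** — THE CLUSTER LIFT under the surjectivity clause:
  `π : O ↠ k`, `ker π ≤ jacobson ⊥`, sections `a_t` on charts `i_t`, exponents `m_t`, `g ∈ k[T_σ]_d` of order `≥ m_t` at each `ā_t`,
  and «every family of classes `(c_t ∈ k[U] ⧸ 𝔪_{ā_t}^{m_t})_t` is realised by one degree-`d` form» ⇒ a degree-`d` lift `G` of `g` of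
  order `≥ m_t` along every section (`+ _of_isLocalRing`).

References: parts 1–5. res-L1-w45b-lead-2 LEAD-MEMO-6 ce04132e6e77d044 §3 (OURS planning text, index only).
-/

set_option linter.dupNamespace false -- mandated namespace `Summit.<Summit>.<Problem>` of this single-conjunct summit

noncomputable section

open MvPolynomial Literature.AlgebraicGeometry.Resolution

namespace Summit.ResolutionOfSingularities.ResolutionOfSingularities.Theorems.EquisingularLiftNat.ClusterLift

section Surj

variable {k : Type*} [CommRing k] {σ : Type*} [Finite σ] [DecidableEq σ] {ι : Type*} (i : ι → σ)
variable (a : (t : ι) → {j : σ // j ≠ i t} → k) (m : ι → ℕ)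

/-- From prescribed CLASSES to prescribed JETS: if every family of classes modulo `𝔪_{a_t}^{m_t}` is realised by a degree-`d` form,
then so is every family of jets of order `< m_t`. [OURS · L1 W4.5b] -/
theorem forall_coeff_eq_of_forall_mk_eq {d : ℕ}
    (hsurj : ∀ c : (t : ι) → MvPolynomial {j : σ // j ≠ i t} k ⧸
        (Ideal.span (Set.range fun j => (X j : MvPolynomial {j : σ // j ≠ i t} k) - C (a t j))) ^ m t,
      ∃ g : MvPolynomial σ k, g.IsHomogeneous d ∧ ∀ t,
        Ideal.Quotient.mk ((Ideal.span (Set.range fun j => (X j : MvPolynomial {j : σ // j ≠ i t} k) - C (a t j))) ^ m t)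
          (dehomogenize (i t) g) = c t)
    (v : (t : ι) → ({j : σ // j ≠ i t} →₀ ℕ) → k) :
    ∃ g : MvPolynomial σ k, g.IsHomogeneous d ∧ ∀ t (α : {j : σ // j ≠ i t} →₀ ℕ), α.degree < m t →
      coeff α (aeval (fun j => (X j : MvPolynomial {j : σ // j ≠ i t} k) + C (a t j)) (dehomogenize (i t) g)) = v t α := by
  classical
  haveI : ∀ t, Fintype {α : {j : σ // j ≠ i t} →₀ ℕ // α.degree < m t} :=
    fun t => @Fintype.ofFinite _ (finite_subtype_degree_lt (m t))
  let S : (t : ι) → Finset ({j : σ // j ≠ i t} →₀ ℕ) := fun t =>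
    Finset.univ.map (Function.Embedding.subtype fun α : {j : σ // j ≠ i t} →₀ ℕ => α.degree < m t)
  have hS : ∀ t (α : {j : σ // j ≠ i t} →₀ ℕ), α.degree < m t → α ∈ S t := fun t α hα => by
    simp only [S, Finset.mem_map, Finset.mem_univ, Function.Embedding.coe_subtype, true_and, Subtype.exists,
      exists_prop, exists_eq_right]; exact hα
  let J : (t : ι) → MvPolynomial {j : σ // j ≠ i t} k := fun t =>
    aeval (fun l => (X l : MvPolynomial {j : σ // j ≠ i t} k) - C (a t l)) (∑ β ∈ S t, monomial β (v t β))
  obtain ⟨g, hg, hgc⟩ := hsurj fun t => Ideal.Quotient.mk _ (J t)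
  refine ⟨g, hg, fun t α hα => ?_⟩
  rw [coeff_eq_of_sub_mem_pow_span_X_sub_C (a t) (m t) (Ideal.Quotient.eq.mp (hgc t)) α hα]
  exact coeff_aeval_X_add_C_jetPoly (a t) (S t) (v t) (hS t α hα)

omit [Finite σ] [DecidableEq σ] in
/-- From prescribed JETS to prescribed CLASSES: if every family of jets of order `< m_t` is realised by a degree-`d` form, then so
is every family of classes modulo `𝔪_{a_t}^{m_t}`. [OURS · L1 W4.5b] -/
theorem forall_mk_eq_of_forall_coeff_eq [DecidableEq σ] {d : ℕ}
    (hind : ∀ v : (t : ι) → ({j : σ // j ≠ i t} →₀ ℕ) → k, ∃ g : MvPolynomial σ k, g.IsHomogeneous d ∧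
      ∀ t (α : {j : σ // j ≠ i t} →₀ ℕ), α.degree < m t →
        coeff α (aeval (fun j => (X j : MvPolynomial {j : σ // j ≠ i t} k) + C (a t j)) (dehomogenize (i t) g)) = v t α)
    (c : (t : ι) → MvPolynomial {j : σ // j ≠ i t} k ⧸
      (Ideal.span (Set.range fun j => (X j : MvPolynomial {j : σ // j ≠ i t} k) - C (a t j))) ^ m t) :
    ∃ g : MvPolynomial σ k, g.IsHomogeneous d ∧ ∀ t,
      Ideal.Quotient.mk ((Ideal.span (Set.range fun j => (X j : MvPolynomial {j : σ // j ≠ i t} k) - C (a t j))) ^ m t)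
        (dehomogenize (i t) g) = c t := by
  choose q hq using fun t => Ideal.Quotient.mk_surjective (c t)
  obtain ⟨g, hg, hjet⟩ := hind fun t α =>
    coeff α (aeval (fun j => (X j : MvPolynomial {j : σ // j ≠ i t} k) + C (a t j)) (q t))
  refine ⟨g, hg, fun t => ?_⟩
  rw [← hq t]
  exact Ideal.Quotient.eq.mpr (sub_mem_pow_span_X_sub_C_of_forall_coeff_eq (a t) (m t) (hjet t))

/-- **The independence clause two ways.** Part 1's jet clause `hind` («every family of jets of order `< m_t` at the points `a_t` is the
family of jets of ONE degree-`d` form») is EQUIVALENT to the surjectivity of `k[T_σ]_d → Π_t k[U_{≠ i_t}] ⧸ 𝔪_{a_t}^{m_t}` — the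
chart-level spelling of «`H⁰(e, 𝒪_e(d)) → ⊕_t 𝒪_{e,q_t}/𝔪_{q_t}^{m_t}` is onto» (res-L1-w45b-lead-2 LEAD-MEMO-6 §3). [OURS · L1 W4.5b] -/
theorem hind_iff_quotient_surjective {d : ℕ} :
    (∀ v : (t : ι) → ({j : σ // j ≠ i t} →₀ ℕ) → k, ∃ g : MvPolynomial σ k, g.IsHomogeneous d ∧
      ∀ t (α : {j : σ // j ≠ i t} →₀ ℕ), α.degree < m t →
        coeff α (aeval (fun j => (X j : MvPolynomial {j : σ // j ≠ i t} k) + C (a t j)) (dehomogenize (i t) g)) = v t α) ↔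
    (∀ c : (t : ι) → MvPolynomial {j : σ // j ≠ i t} k ⧸
        (Ideal.span (Set.range fun j => (X j : MvPolynomial {j : σ // j ≠ i t} k) - C (a t j))) ^ m t,
      ∃ g : MvPolynomial σ k, g.IsHomogeneous d ∧ ∀ t,
        Ideal.Quotient.mk ((Ideal.span (Set.range fun j => (X j : MvPolynomial {j : σ // j ≠ i t} k) - C (a t j))) ^ m t)
          (dehomogenize (i t) g) = c t) :=
  ⟨fun h => forall_mk_eq_of_forall_coeff_eq i a m h, fun h => forall_coeff_eq_of_forall_mk_eq i a m h⟩

end Surj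

section SurjLift

variable {O k : Type*} [CommRing O] [CommRing k] (π : O →+* k) {σ : Type*} [Finite σ] [DecidableEq σ]
variable {ι : Type*} [Finite ι]

/-- **THE CLUSTER LIFT UNDER THE SURJECTIVITY CLAUSE.** `π : O ↠ k`, `ker π ≤ jacobson ⊥` (e.g. `O` local); sections `a_t` on charts
`i_t`, exponents `m_t`; DOWNSTAIRS CLAUSE: every family of classes `c_t ∈ k[U_{≠ i_t}] ⧸ 𝔪_{ā_t}^{m_t}` is `(g'(T_{i_t} := 1) mod 𝔪_{ā_t}^{m_t})_t`
for one degree-`d` form `g'` («`H⁰(𝒪_e(d)) → ⊕ 𝒪_{e,q_t}/𝔪^{m_t}` onto», `h¹ = 0`); `g ∈ k[T_σ]_d` of order `≥ m_t` at every `ā_t`.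
THEN a degree-`d` form `G` over `O` with `map π G = g` and `G(T_{i_t} := 1) ∈ 𝔪_{a_t}^{m_t}` for all `t`. [OURS · L1 W4.5b] -/
theorem exists_isHomogeneous_lift_forall_dehomogenize_mem_pow_of_quotient_surjective (hπ : Function.Surjective π)
    (hker : RingHom.ker π ≤ (⊥ : Ideal O).jacobson) {d : ℕ} (i : ι → σ) (a : (t : ι) → {j : σ // j ≠ i t} → O)
    (m : ι → ℕ)
    (hsurj : ∀ c : (t : ι) → MvPolynomial {j : σ // j ≠ i t} k ⧸
        (Ideal.span (Set.range fun j => (X j : MvPolynomial {j : σ // j ≠ i t} k) - C (π (a t j)))) ^ m t,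
      ∃ g : MvPolynomial σ k, g.IsHomogeneous d ∧ ∀ t,
        Ideal.Quotient.mk
            ((Ideal.span (Set.range fun j => (X j : MvPolynomial {j : σ // j ≠ i t} k) - C (π (a t j)))) ^ m t)
          (dehomogenize (i t) g) = c t)
    (g : MvPolynomial σ k) (hg : g.IsHomogeneous d)
    (hgZ : ∀ t, dehomogenize (i t) g ∈
      (Ideal.span (Set.range fun j => (X j : MvPolynomial {j : σ // j ≠ i t} k) - C (π (a t j)))) ^ m t) :
    ∃ G : MvPolynomial σ O, G.IsHomogeneous d ∧ MvPolynomial.map π G = g ∧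
      ∀ t, dehomogenize (i t) G ∈
        (Ideal.span (Set.range fun j => (X j : MvPolynomial {j : σ // j ≠ i t} O) - C (a t j))) ^ m t :=
  exists_isHomogeneous_lift_forall_dehomogenize_mem_pow π hπ hker i a m
    (forall_coeff_eq_of_forall_mk_eq i (fun t j => π (a t j)) m hsurj) g hg hgZ

/-- **The cluster lift under the surjectivity clause, over a local ring.** [OURS · L1 W4.5b] -/
theorem exists_isHomogeneous_lift_forall_dehomogenize_mem_pow_of_quotient_surjective_of_isLocalRing [IsLocalRing O]
    [Nontrivial k] (hπ : Function.Surjective π) {d : ℕ} (i : ι → σ) (a : (t : ι) → {j : σ // j ≠ i t} → O) (m : ι → ℕ)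
    (hsurj : ∀ c : (t : ι) → MvPolynomial {j : σ // j ≠ i t} k ⧸
        (Ideal.span (Set.range fun j => (X j : MvPolynomial {j : σ // j ≠ i t} k) - C (π (a t j)))) ^ m t,
      ∃ g : MvPolynomial σ k, g.IsHomogeneous d ∧ ∀ t,
        Ideal.Quotient.mk
            ((Ideal.span (Set.range fun j => (X j : MvPolynomial {j : σ // j ≠ i t} k) - C (π (a t j)))) ^ m t)
          (dehomogenize (i t) g) = c t)
    (g : MvPolynomial σ k) (hg : g.IsHomogeneous d)
    (hgZ : ∀ t, dehomogenize (i t) g ∈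
      (Ideal.span (Set.range fun j => (X j : MvPolynomial {j : σ // j ≠ i t} k) - C (π (a t j)))) ^ m t) :
    ∃ G : MvPolynomial σ O, G.IsHomogeneous d ∧ MvPolynomial.map π G = g ∧
      ∀ t, dehomogenize (i t) G ∈
        (Ideal.span (Set.range fun j => (X j : MvPolynomial {j : σ // j ≠ i t} O) - C (a t j))) ^ m t :=
  exists_isHomogeneous_lift_forall_dehomogenize_mem_pow_of_quotient_surjective π hπ (ker_le_jacobson_bot_of_isLocalRing π)
    i a m hsurj g hg hgZ

end SurjLift

end Summit.ResolutionOfSingularities.ResolutionOfSingularities.Theorems.EquisingularLiftNat.ClusterLift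

end
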